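import Summits.Parity.GeneralizedHardyLittlewood.Theorems.LeeYangFibresPrimeCellsRelativeWeightedFromMean
import HarnessLib

/-!
# Route `LeeYangFibres`, crux `PrimeCellsRelative` (stmt-Parity-14112), line `SketchIdeator4`
# (card `sieve-out-to-chowla`): the stub `stub_weightedFromMeanPos`

**`stub_weightedFromMeanPos : ∀ t, LiouvilleTupleMeanPos t → WeightedTupleClassSumsPos t`.**  The
reshape of the landed `stub_weightedFromMean` (module
`…Theorems.LeeYangFibresPrimeCellsRelativeWeightedFromMean`): the corrected, conjecture-grade
mean-value input of the line (`LiouvilleTupleMeanPos t`: for every `L, A` a level exponent `η > 0`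
with `Σ_{d ≤ N^η sqfree} |F_S([m₁,m₂]; d, r_d)| ≤ C N/(log N)^A` for every integer interval
`[m₁,m₂] ⊆ [−N,N]` ON WHICH EVERY FORM IS `≥ 1`, every `|S| ≥ 2` and EVERY choice of residues
`r`) is turned into the weighted root-class form consumed by the sieve transfer on the same
intervals (`WeightedTupleClassSumsPos t`:
`Σ_{d ≤ N^η sqfree} Σ_{s mod d, d ∣ F_Ψ(s)} |F_S([m₁,m₂]; d, s)| ≤ C N/(log N)^{t+1}`).

Proof: VERBATIM the landed proof of `stub_weightedFromMean`, with the positivity hypothesis of the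
interval threaded through to the one application of the mean-value hypothesis (it plays no other
role).  Put `B = L + t`, so that `ω_F(p) ≤ B` at every prime (`rootCount_le_add`) and
`ω_F(d) ≤ B^{ω(d)}` for squarefree `d` (`rootCount_le_pow_omega`).  Per modulus keep the worst
root class `M_d = |F_S(d, s_d)|` (`exists_sum_le_card_mul`), so `rootClassSums ≤ Σ_d ω_F(d) M_d`.
Cauchy–Schwarz: `(Σ_d ω_F(d) M_d)² ≤ (Σ_d ω_F(d)² M_d)(Σ_d M_d)`.  The second factor is
`≤ C_A N/(log N)^A` by the hypothesis at the residues `r_d = s_d`, `A = 2B² + 2t + 2`; the first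
is `≤ 4N e^{10B²}(log N)^{2B²}` by the trivial bound `M_d ≤ 3N/d + 1`
(`abs_classSum_le_card_div_add_one`, landed) and `Σ_{d ≤ D} B^{2ω(d)}/d ≤ e^{2B²(log log D + 5)}`,
`Σ_{d ≤ D} B^{2ω(d)} ≤ D e^{2B²(log log D + 5)}` with `D = ⌊N^{min(η,1)}⌋ ≤ N`.  Hence
`rootClassSums ≤ 2 e^{5B²} √C_A · N/(log N)^{t+1}`; the output level exponent is `min(η, 1)`.

References: H. Halberstam, H.-E. Richert, *Sieve Methods* (1974), Ch. 2 and §5.7 (the `k^{ω(d)}`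
weights and Cauchy–Schwarz) [HalberstamRichert1974].
-/

noncomputable section

open scoped BigOperators Classical
open Finset Filter

namespace Summit.Parity.GeneralizedHardyLittlewood.Cruxes.PrimeCellsRelative.SieveOutToChowla

open Literature.NumberTheory.Sieve
open Summit.Parity.GeneralizedHardyLittlewood.Theorems.AbsoluteUpgrade
open scoped ArithmeticFunction.omega

/-! ### The stub: `LiouvilleTupleMeanPos t → WeightedTupleClassSumsPos t` -/

/-- **Weighted form of the corrected parity input, from the mean-value form by Cauchy–Schwarz.**
`LiouvilleTupleMeanPos t → WeightedTupleClassSumsPos t`: on an integer interval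
`[m₁,m₂] ⊆ [−N,N]` on which every form is `≥ 1`, per squarefree modulus `d` keep the worst of the
`ω_F(d) ≤ (L+t)^{ω(d)}` root classes (`M_d`), so `rootClassSums ≤ Σ_d ω_F(d) M_d`; then
`(Σ_d ω_F(d) M_d)² ≤ (Σ_d ω_F(d)² M_d)(Σ_d M_d)`, where the first factor is
`≤ 4N e^{10B²} (log N)^{2B²}` by the trivial bound `M_d ≤ 3N/d + 1` and
`Σ_{d ≤ D} B^{2ω(d)}/d ≤ e^{2B²(log log D + 5)}` (`B = L + t`, `D ≤ N`), and the second is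
`≤ C_A N/(log N)^A` by `LiouvilleTupleMeanPos t` (on the same positive interval) at
`A = 2B² + 2t + 2` and the worst-class residues; the level exponent is `min η 1`.  Registered stub
`stub_weightedFromMeanPos` of the line `SketchIdeator4` (crux `PrimeCellsRelative`; reshape of the
landed `stub_weightedFromMean`). [cite: HalberstamRichert1974, Ch. 2 §5.7] -/
theorem stub_weightedFromMeanPos : ∀ t : ℕ, LiouvilleTupleMeanPos t → WeightedTupleClassSumsPos t := by
  intro t hLTM L
  -- constants
  obtain ⟨B, hB⟩ : ∃ B : ℕ, B = L + t := ⟨_, rfl⟩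
  obtain ⟨A, hA⟩ : ∃ A : ℕ, A = 2 * B ^ 2 + 2 * t + 2 := ⟨_, rfl⟩
  obtain ⟨η, hη, Ch, N₁, hmean⟩ := hLTM L (A : ℝ)
  set Cb : ℝ := max Ch 0 with hCb
  have hCb0 : 0 ≤ Cb := le_max_right _ _
  set c₀ : ℝ := Real.sqrt (4 * Real.exp (10 * (B : ℝ) ^ 2) * Cb) with hc₀
  have hc₀0 : 0 ≤ c₀ := Real.sqrt_nonneg _
  obtain ⟨N₀, hN₀⟩ :=
    Filter.eventually_atTop.1 ((Filter.eventually_ge_atTop N₁).and eventually_basic)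
  set η' : ℝ := min η 1 with hη'
  refine ⟨η', lt_min hη one_pos, c₀, N₀, fun N hN Ψ hΨ hL m₁ m₂ hI hpos S hS => ?_⟩
  obtain ⟨hNN₁, hN16, hlog1⟩ := hN₀ N hN
  have hN0 : (0 : ℝ) < N := by linarith
  have hN1 : (1 : ℝ) ≤ N := by linarith
  set Lg := Real.log N with hLg
  have hLg0 : 0 < Lg := by linarith
  -- the level `D = ⌊N^{η'}⌋ ≤ N`, `D ≤ ⌊N^η⌋`
  set D : ℕ := ⌊(N : ℝ) ^ η'⌋₊ with hD
  have hDN : (D : ℝ) ≤ N := by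
    calc (D : ℝ) ≤ (N : ℝ) ^ η' := Nat.floor_le (by positivity)
      _ ≤ (N : ℝ) ^ (1 : ℝ) := Real.rpow_le_rpow_of_exponent_le hN1 (min_le_right _ _)
      _ = N := Real.rpow_one _
  have hDη : D ≤ ⌊(N : ℝ) ^ η⌋₊ :=
    Nat.floor_le_floor (Real.rpow_le_rpow_of_exponent_le hN1 (min_le_left _ _))
  set 𝒟 := (Finset.Icc 1 D).filter Squarefree with h𝒟
  have hmem𝒟 : ∀ d ∈ 𝒟, 1 ≤ d ∧ d ≤ D ∧ Squarefree d := fun d hd => by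
    rw [h𝒟, Finset.mem_filter, Finset.mem_Icc] at hd
    exact ⟨hd.1.1, hd.1.2, hd.2⟩
  -- root counts `ω_F(d) ≤ B^{ω(d)}`
  set F := sysPoly Ψ with hF
  have haL : ∀ k, ((Ψ k).coeff 0).natAbs ≤ L := fun k =>
    natAbs_coeff_le_of_affLinSize_le hL k 0
  have hFB : ∀ p : ℕ, p.Prime → polyRootCountMod ![F] p ≤ B := fun p hp => by
    rw [hB]; exact rootCount_le_add hΨ haL hp
  set ρ : ℕ → ℝ := fun d => (polyRootCountMod ![F] d : ℝ) with hρ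
  have hρ0 : ∀ d, 0 ≤ ρ d := fun d => Nat.cast_nonneg _
  have hρB : ∀ d ∈ 𝒟, ρ d ≤ (B : ℝ) ^ ω d := fun d hd =>
    rootCount_le_pow_omega hFB (hmem𝒟 d hd).2.2
  -- worst class per modulus
  have hsel : ∀ d : ℕ, ∃ s : ℕ,
      ∑ s' ∈ rootsMod F d, |classSum Ψ S m₁ m₂ d (s' : ℤ)| ≤ ρ d * |classSum Ψ S m₁ m₂ d (s : ℤ)| :=
    fun d => by
    obtain ⟨s, hs⟩ :=
      exists_sum_le_card_mul (rootsMod F d) (fun s' => |classSum Ψ S m₁ m₂ d (s' : ℤ)|)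
    rw [card_rootsMod] at hs
    exact ⟨s, hs⟩
  choose sst hsst using hsel
  set r : ℕ → ℤ := fun d => (sst d : ℤ) with hr
  set M : ℕ → ℝ := fun d => |classSum Ψ S m₁ m₂ d (r d)| with hM
  have hM0 : ∀ d, 0 ≤ M d := fun d => abs_nonneg _
  -- (I) the mean-value hypothesis at the worst-class residues (on the positive interval)
  have hIst : ∑ d ∈ 𝒟, M d ≤ Cb * N / Lg ^ A := by
    have h1 := hmean N hNN₁ Ψ hΨ hL m₁ m₂ hI hpos S hS r
    calc ∑ d ∈ 𝒟, M d
        ≤ ∑ d ∈ (Finset.Icc 1 ⌊(N : ℝ) ^ η⌋₊).filter Squarefree, M d := by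
          refine Finset.sum_le_sum_of_subset_of_nonneg ?_ fun d _ _ => hM0 d
          exact Finset.filter_subset_filter _ (Finset.Icc_subset_Icc_right hDη)
      _ ≤ Ch * N / Lg ^ (A : ℝ) := h1
      _ ≤ Cb * N / Lg ^ A := by
          rw [Real.rpow_natCast]
          exact div_le_div_of_nonneg_right (mul_le_mul_of_nonneg_right (le_max_left _ _) hN0.le)
            (by positivity)
  -- (II) the trivial bound `M_d ≤ 3N/d + 1` and the weighted trivial sum
  have hcardI : (#(Finset.Icc m₁ m₂) : ℝ) ≤ 2 * N + 1 := card_Icc_le_of_subset hI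
  have hMtriv : ∀ d ∈ 𝒟, M d ≤ 3 * N / d + 1 := by
    intro d hd
    obtain ⟨hd1, -, -⟩ := hmem𝒟 d hd
    have hd0 : (0 : ℝ) < d := by exact_mod_cast hd1
    calc M d ≤ (#(Finset.Icc m₁ m₂) : ℝ) / d + 1 :=
          abs_classSum_le_card_div_add_one Ψ S m₁ m₂ hd1 (r d)
      _ ≤ (2 * N + 1) / d + 1 := by gcongr
      _ ≤ 3 * N / d + 1 := by gcongr; linarith
  set D' : ℕ := max D 2 with hD'
  have hD'2 : 2 ≤ D' := le_max_right _ _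
  have hD'N : ((D' : ℕ) : ℝ) ≤ N := by
    rw [hD']
    rcases le_total D 2 with h | h
    · rw [max_eq_right h]; push_cast; linarith
    · rw [max_eq_left h]; exact hDN
  have hsub𝒟 : 𝒟 ⊆ Finset.Icc 1 D' := fun d hd => by
    obtain ⟨hd1, hdD, -⟩ := hmem𝒟 d hd
    exact Finset.mem_Icc.mpr ⟨hd1, hdD.trans (le_max_left _ _)⟩
  have hloglog : Real.log (Real.log D') ≤ Real.log Lg := by
    have h2 : (2 : ℝ) ≤ D' := by exact_mod_cast hD'2
    have hlogD : 0 < Real.log D' := Real.log_pos (by linarith)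
    exact Real.log_le_log hlogD (Real.log_le_log (by linarith) hD'N)
  set E : ℝ := Real.exp (10 * (B : ℝ) ^ 2) * Lg ^ (2 * B ^ 2) with hE
  have hexpw : Real.exp (2 * (B : ℝ) ^ 2 * (Real.log (Real.log D') + 5)) ≤ E := by
    have hLpow : Real.exp (2 * (B : ℝ) ^ 2 * Real.log Lg) = Lg ^ (2 * B ^ 2) := by
      rw [← exp_natMul_log hLg0]; congr 1; push_cast; ring
    rw [hE, ← hLpow, ← Real.exp_add]
    refine Real.exp_le_exp.mpr ?_
    have := mul_le_mul_of_nonneg_left hloglog (by positivity : (0 : ℝ) ≤ 2 * (B : ℝ) ^ 2)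
    nlinarith
  have hE0 : 0 ≤ E := by positivity
  have hII : ∑ d ∈ 𝒟, ρ d ^ 2 * M d ≤ 4 * N * E := by
    calc ∑ d ∈ 𝒟, ρ d ^ 2 * M d
        ≤ ∑ d ∈ 𝒟, (3 * N * (((B : ℝ) ^ 2) ^ ω d / d) + ((B : ℝ) ^ 2) ^ ω d) := by
          refine Finset.sum_le_sum fun d hd => ?_
          have hd0 : (0 : ℝ) < d := by exact_mod_cast (hmem𝒟 d hd).1
          calc ρ d ^ 2 * M d ≤ ((B : ℝ) ^ ω d) ^ 2 * (3 * N / d + 1) :=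
                mul_le_mul (pow_le_pow_left₀ (hρ0 d) (hρB d hd) 2) (hMtriv d hd) (hM0 d)
                  (by positivity)
            _ = 3 * N * (((B : ℝ) ^ 2) ^ ω d / d) + ((B : ℝ) ^ 2) ^ ω d := by
                rw [← pow_mul, mul_comm (ω d) 2, pow_mul]; ring
      _ = 3 * N * ∑ d ∈ 𝒟, ((B : ℝ) ^ 2) ^ ω d / d +
            ∑ d ∈ 𝒟, ((B : ℝ) ^ 2) ^ ω d := by
          rw [Finset.sum_add_distrib, Finset.mul_sum]
      _ ≤ 3 * N * ∑ d ∈ Finset.Icc 1 D', ((B : ℝ) ^ 2) ^ ω d / d +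
            ∑ d ∈ Finset.Icc 1 D', ((B : ℝ) ^ 2) ^ ω d := by
          refine add_le_add (mul_le_mul_of_nonneg_left ?_ (by positivity)) ?_
          · exact Finset.sum_le_sum_of_subset_of_nonneg hsub𝒟 fun d _ _ => by positivity
          · exact Finset.sum_le_sum_of_subset_of_nonneg hsub𝒟 fun d _ _ => by positivity
      _ ≤ 3 * N * Real.exp (2 * (B : ℝ) ^ 2 * (Real.log (Real.log D') + 5)) +
            D' * Real.exp (2 * (B : ℝ) ^ 2 * (Real.log (Real.log D') + 5)) :=
          add_le_add (mul_le_mul_of_nonneg_left (sum_pow_omega_div_le (by positivity) hD'2)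
            (by positivity)) (sum_pow_omega_le (by positivity) hD'2)
      _ ≤ 3 * N * E + N * E :=
          add_le_add (mul_le_mul_of_nonneg_left hexpw (by positivity))
            (mul_le_mul hD'N hexpw (Real.exp_pos _).le hN0.le)
      _ = 4 * N * E := by ring
  -- (III) Cauchy–Schwarz
  have hIII : ∑ d ∈ 𝒟, ρ d * M d ≤ c₀ * N / Lg ^ (t + 1) := by
    have hCS := Finset.sum_mul_sq_le_sq_mul_sq 𝒟 (fun d => ρ d * Real.sqrt (M d))
      (fun d => Real.sqrt (M d))
    have e1 : ∀ d ∈ 𝒟, ρ d * Real.sqrt (M d) * Real.sqrt (M d) = ρ d * M d := fun d _ => by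
      rw [mul_assoc, Real.mul_self_sqrt (hM0 d)]
    have e2 : ∀ d ∈ 𝒟, (ρ d * Real.sqrt (M d)) ^ 2 = ρ d ^ 2 * M d := fun d _ => by
      rw [mul_pow, Real.sq_sqrt (hM0 d)]
    have e3 : ∀ d ∈ 𝒟, Real.sqrt (M d) ^ 2 = M d := fun d _ => Real.sq_sqrt (hM0 d)
    rw [Finset.sum_congr rfl e1, Finset.sum_congr rfl e2, Finset.sum_congr rfl e3] at hCS
    have hK : (∑ d ∈ 𝒟, ρ d * M d) ^ 2 ≤ (c₀ * N / Lg ^ (t + 1)) ^ 2 := by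
      calc (∑ d ∈ 𝒟, ρ d * M d) ^ 2
          ≤ (∑ d ∈ 𝒟, ρ d ^ 2 * M d) * ∑ d ∈ 𝒟, M d := hCS
        _ ≤ (4 * N * E) * (Cb * N / Lg ^ A) :=
            mul_le_mul hII hIst (Finset.sum_nonneg fun d _ => hM0 d) (by positivity)
        _ = (c₀ * N / Lg ^ (t + 1)) ^ 2 := by
            rw [hc₀, div_pow, mul_pow, Real.sq_sqrt (by positivity), hA, hE]
            have hLA : Lg ^ (2 * B ^ 2 + 2 * t + 2) = Lg ^ (2 * B ^ 2) * (Lg ^ (t + 1)) ^ 2 := by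
              rw [← pow_mul, ← pow_add]; congr 1; ring
            rw [hLA]
            field_simp
    have hpos' : 0 ≤ c₀ * N / Lg ^ (t + 1) := by positivity
    exact (abs_le_of_sq_le_sq' hK hpos').2
  -- assembly: `rootClassSums ≤ Σ_d ω_F(d) M_d`
  have hinner : rootClassSums Ψ S m₁ m₂ D ≤ ∑ d ∈ 𝒟, ρ d * M d := by
    unfold rootClassSums
    exact Finset.sum_le_sum fun d _ => hsst d
  exact hinner.trans hIII

end Summit.Parity.GeneralizedHardyLittlewood.Cruxes.PrimeCellsRelative.SieveOutToChowla

end
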